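import Mathlib
import Literature.Computability.Complexity.FourierTails
import Literature.Computability.Complexity.XorFiberGrowth
import HarnessLib

/-!
# `LiouvilleOrthogonalTC0` (stmt-QuantumAdvantage-1393), line `Sketch` — stub `stub_peresTail`
# (Peres' theorem in Fourier-tail form: `W^{≥m}[sgn ∘ f] ≤ 3/√m` for linear threshold functions)

For a linear threshold function `f(x) = [θ ≤ Σ_i w_i x_i]` of `n` Boolean variables and `m ≥ 1`,
the Fourier weight of `F = sgn ∘ f` above level `m` is at most `3/√m`, uniformly in `n` and in the
weights (Y. Peres, *Noise stability of weighted majority*, 2004; O'Donnell, *Analysis of Boolean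
Functions*, 2014, §5.5), GIVEN the total-influence bound for threshold functions on `{0,1}^m`
(hypothesis `hInf`, the registered neighbour stub `stub_ltfInfluence`):
`Σ_σ #{j : g(σ) ≠ g(σ^{⊕j})} ≤ 2^m √m` for every `g(σ) = [Θ ≤ Σ_l W_l σ_l]`.

Proof (Peres' random-partition argument, O'Donnell §5.5). For a map `π : [n] → [m]` ("partition
into `m` blocks") and `j ∈ [m]` let `x ⊕ e_{π,j}` flip the bits of block `π⁻¹(j)`.
* Spectral side (`StubPeresTail.spectral_side`): `Σ_x F(x) F(x ⊕ z) = 2^n Σ_S F̂(S)² χ_S(z)`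
  (`corr_eq`, Fourier inversion and multiplicativity of characters `LowDegree.sgn_xor`) and
  `Σ_π χ_S(e_{π,j}) = m^n (1 - 2/m)^{|S|}` (`sum_pi_walsh`, `Fintype.prod_sum`), so
  `Σ_π Σ_j Σ_x F(x) F(x ⊕ e_{π,j}) = 2^n m^n m · Σ_S F̂(S)² (1-2/m)^{|S|}`.
* Counting side (`counting_side`): `F(x)F(y) = 1 - 2[f x ≠ f y]`, so the same sum is
  `m^n m 2^n - 2 Σ_π Σ_x #{j : f(x) ≠ f(x ⊕ e_{π,j})}`.
* Peres' bound (`sum_le_of_translates` + `ltf_translate`): for fixed `π`, the translate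
  `σ ↦ f(x ⊕ π^*σ)` is again a threshold function of `σ ∈ {0,1}^m`, its sensitive pairs at `σ` are
  the sensitive blocks of `f` at `x ⊕ π^*σ` (`xor_update_not`), and `x ↦ x ⊕ π^*σ` is a bijection
  (`sum_translate`); averaging `hInf` over `σ` gives `Σ_x #{j : f(x) ≠ f(x ⊕ e_{π,j})} ≤ 2^n √m`.
* Hence `Σ_S F̂(S)² (1 - (1-2/m)^{|S|}) ≤ 2/√m`; for `|S| ≥ m ≥ 10`,
  `(1-2/m)^{|S|} ≤ (1-2/m)^m ≤ e^{-2} ≤ 1/3` (`Real.one_sub_div_pow_le_exp_neg`,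
  `Real.add_one_le_exp`), so `(2/3) W^{≥m} ≤ 2/√m` (`tailWeight_le_of_sens`, `final_bound`);
  for `m ≤ 9` the bound `W^{≥m} ≤ 1 ≤ 3/√m` is trivial (`tailWeight_le_one`).
-/

set_option linter.dupNamespace false -- D-0017: single-problem summit ⇒ `QuantumAdvantage.QuantumAdvantage` by design

noncomputable section

namespace Summit.QuantumAdvantage.QuantumAdvantage.Theorems.LiouvilleOrthogonalTC0

open Finset
open Literature.Computability.Complexity.LowDegree (tailWeight cubeFourierCoeff
  sum_cubeFourierCoeff_mul_walsh sum_cubeFourierCoeff_sq walsh_eq_prod_ite tailWeight_le_one sgn_xor)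
open Literature.Probability.RandomGraphs.LowDegree (sgn walsh)

namespace StubPeresTail

variable {n m : ℕ}

/-- Characters are multiplicative under translation: `χ_S(x ⊕ z) = χ_S(x) χ_S(z)` (the tree's
`LowDegree.walsh_xorVec` for an explicit lambda, via `LowDegree.sgn_xor`). -/
theorem walsh_xor (S : Finset (Fin n)) (x z : Fin n → Bool) :
    walsh S (fun i => xor (x i) (z i)) = walsh S x * walsh S z := by
  simp only [walsh, sgn_xor, Finset.prod_mul_distrib]

/-- **Autocorrelation in the Walsh basis**: `Σ_x F(x) F(x ⊕ z) = 2^n Σ_S F̂(S)² χ_S(z)`. -/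
theorem corr_eq (F : (Fin n → Bool) → ℝ) (z : Fin n → Bool) :
    ∑ x, F x * F (fun i => xor (x i) (z i)) = 2 ^ n * ∑ S, cubeFourierCoeff F S ^ 2 * walsh S z := by
  have hinv : ∀ x : Fin n → Bool,
      F (fun i => xor (x i) (z i)) = ∑ S, cubeFourierCoeff F S * (walsh S x * walsh S z) := by
    intro x
    rw [← sum_cubeFourierCoeff_mul_walsh F (fun i => xor (x i) (z i))]
    exact Finset.sum_congr rfl fun S _ => by rw [walsh_xor]
  have hc : ∀ S : Finset (Fin n), ∑ x, F x * walsh S x = 2 ^ n * cubeFourierCoeff F S := by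
    intro S
    rw [cubeFourierCoeff]
    field_simp
  calc ∑ x, F x * F (fun i => xor (x i) (z i))
      = ∑ x, ∑ S, cubeFourierCoeff F S * walsh S z * (F x * walsh S x) := by
        refine Finset.sum_congr rfl fun x _ => ?_
        rw [hinv, Finset.mul_sum]
        exact Finset.sum_congr rfl fun S _ => by ring
    _ = ∑ S, cubeFourierCoeff F S * walsh S z * ∑ x, F x * walsh S x := by
        rw [Finset.sum_comm]
        exact Finset.sum_congr rfl fun S _ => by rw [Finset.mul_sum]
    _ = 2 ^ n * ∑ S, cubeFourierCoeff F S ^ 2 * walsh S z := by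
        rw [Finset.mul_sum]
        exact Finset.sum_congr rfl fun S _ => by rw [hc]; ring

/-- `Σ_{a ∈ [m]} (-1)^{[a = j]} = m - 2`. -/
theorem sum_sgn_decide_eq (j : Fin m) : ∑ a : Fin m, sgn (decide (a = j)) = (m : ℝ) - 2 := by
  have h : ∀ a : Fin m, sgn (decide (a = j)) = 1 - 2 * (if a = j then (1 : ℝ) else 0) := by
    intro a
    by_cases ha : a = j
    · norm_num [ha]
    · simp [ha]
  simp_rw [h]
  rw [Finset.sum_sub_distrib, ← Finset.mul_sum, Finset.sum_ite_eq']
  simp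

/-- **Averaging a character over partitions**: `Σ_{π : [n] → [m]} χ_S(e_{π,j}) = m^n (1 - 2/m)^{|S|}`,
where `e_{π,j} = ([π i = j])_i` (`Fintype.prod_sum`). -/
theorem sum_pi_walsh (hm : 1 ≤ m) (S : Finset (Fin n)) (j : Fin m) :
    ∑ π : Fin n → Fin m, walsh S (fun i => decide (π i = j)) =
      (m : ℝ) ^ n * (1 - 2 / (m : ℝ)) ^ S.card := by
  have hm0 : (m : ℝ) ≠ 0 := Nat.cast_ne_zero.2 (by omega)
  have h1 : ∀ π : Fin n → Fin m, walsh S (fun i => decide (π i = j)) =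
      ∏ i, (if i ∈ S then sgn (decide (π i = j)) else (1 : ℝ)) :=
    fun π => walsh_eq_prod_ite S _
  simp_rw [h1]
  rw [← Fintype.prod_sum fun (i : Fin n) (a : Fin m) => if i ∈ S then sgn (decide (a = j)) else (1 : ℝ)]
  have h2 : ∀ i : Fin n, ∑ a : Fin m, (if i ∈ S then sgn (decide (a = j)) else (1 : ℝ)) =
      (m : ℝ) * (if i ∈ S then (1 - 2 / (m : ℝ)) else 1) := by
    intro i
    split_ifs with hi
    · rw [sum_sgn_decide_eq, mul_sub, mul_one, mul_div_cancel₀ _ hm0]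
    · simp
  rw [Finset.prod_congr rfl fun i _ => h2 i, Finset.prod_mul_distrib, Finset.prod_const,
    Finset.card_univ, Fintype.card_fin, Fintype.prod_ite_mem, Finset.prod_const]

/-- `Σ_π Σ_j χ_S(e_{π,j}) = m · m^n (1 - 2/m)^{|S|}`. -/
theorem sum_pi_sum_walsh (hm : 1 ≤ m) (S : Finset (Fin n)) :
    ∑ π : Fin n → Fin m, ∑ j : Fin m, walsh S (fun i => decide (π i = j)) =
      (m : ℝ) * ((m : ℝ) ^ n * (1 - 2 / (m : ℝ)) ^ S.card) := by
  rw [Finset.sum_comm]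
  simp_rw [sum_pi_walsh hm]
  rw [Finset.sum_const, Finset.card_univ, Fintype.card_fin, nsmul_eq_mul]

/-- **Spectral side**: `Σ_π Σ_j Σ_x F(x) F(x ⊕ e_{π,j}) = 2^n m^n m · Σ_S F̂(S)² (1 - 2/m)^{|S|}`. -/
theorem spectral_side (hm : 1 ≤ m) (F : (Fin n → Bool) → ℝ) :
    ∑ π : Fin n → Fin m, ∑ j : Fin m, ∑ x : Fin n → Bool,
        F x * F (fun i => xor (x i) (decide (π i = j))) =
      2 ^ n * (m : ℝ) ^ n * m *
        ∑ S : Finset (Fin n), cubeFourierCoeff F S ^ 2 * (1 - 2 / (m : ℝ)) ^ S.card := by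
  calc ∑ π : Fin n → Fin m, ∑ j : Fin m, ∑ x : Fin n → Bool,
        F x * F (fun i => xor (x i) (decide (π i = j)))
      = ∑ π : Fin n → Fin m, ∑ j : Fin m, ∑ S : Finset (Fin n),
          2 ^ n * (cubeFourierCoeff F S ^ 2 * walsh S (fun i => decide (π i = j))) := by
        refine Finset.sum_congr rfl fun π _ => Finset.sum_congr rfl fun j _ => ?_
        rw [corr_eq, Finset.mul_sum]
    _ = ∑ π : Fin n → Fin m, ∑ S : Finset (Fin n), ∑ j : Fin m,
          2 ^ n * (cubeFourierCoeff F S ^ 2 * walsh S (fun i => decide (π i = j))) :=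
        Finset.sum_congr rfl fun π _ => Finset.sum_comm
    _ = ∑ S : Finset (Fin n), ∑ π : Fin n → Fin m, ∑ j : Fin m,
          2 ^ n * (cubeFourierCoeff F S ^ 2 * walsh S (fun i => decide (π i = j))) :=
        Finset.sum_comm
    _ = ∑ S : Finset (Fin n),
          2 ^ n * (cubeFourierCoeff F S ^ 2 * ((m : ℝ) * ((m : ℝ) ^ n * (1 - 2 / (m : ℝ)) ^ S.card))) := by
        refine Finset.sum_congr rfl fun S _ => ?_
        rw [← sum_pi_sum_walsh hm S]
        simp only [← Finset.mul_sum]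
    _ = _ := by
        rw [Finset.mul_sum]
        exact Finset.sum_congr rfl fun S _ => by ring

/-- `Σ_j (-1)^a (-1)^{b_j} = m - 2 #{j : a ≠ b_j}`. -/
theorem sum_sgn_mul_sgn (a : Bool) (b : Fin m → Bool) :
    ∑ j, sgn a * sgn (b j) = (m : ℝ) - 2 * ((univ.filter fun j => a ≠ b j).card : ℝ) := by
  have h : ∀ j, sgn a * sgn (b j) = 1 - 2 * (if a ≠ b j then (1 : ℝ) else 0) := by
    intro j
    cases a <;> cases b j <;> norm_num
  simp_rw [h]
  rw [Finset.sum_sub_distrib, ← Finset.mul_sum, Finset.sum_boole]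
  simp

/-- **Counting side**: for `F = sgn ∘ f`,
`Σ_π Σ_j Σ_x F(x) F(x ⊕ e_{π,j}) = m^n · m 2^n - 2 Σ_π Σ_x #{j : f(x) ≠ f(x ⊕ e_{π,j})}`. -/
theorem counting_side (f : (Fin n → Bool) → Bool) :
    ∑ π : Fin n → Fin m, ∑ j : Fin m, ∑ x : Fin n → Bool,
        sgn (f x) * sgn (f (fun i => xor (x i) (decide (π i = j)))) =
      (m : ℝ) ^ n * (m * 2 ^ n) - 2 * ∑ π : Fin n → Fin m, ∑ x : Fin n → Bool,
        ((univ.filter fun j : Fin m => f x ≠ f (fun i => xor (x i) (decide (π i = j)))).card : ℝ) := by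
  have h : ∀ π : Fin n → Fin m, ∑ j : Fin m, ∑ x : Fin n → Bool,
      sgn (f x) * sgn (f (fun i => xor (x i) (decide (π i = j)))) =
        m * 2 ^ n - 2 * ∑ x : Fin n → Bool,
          ((univ.filter fun j : Fin m => f x ≠ f (fun i => xor (x i) (decide (π i = j)))).card : ℝ) := by
    intro π
    rw [Finset.sum_comm]
    simp_rw [sum_sgn_mul_sgn]
    rw [Finset.sum_sub_distrib, Finset.sum_const, Finset.card_univ, Finset.mul_sum]
    simp only [Fintype.card_fun, Fintype.card_bool, Fintype.card_fin, nsmul_eq_mul, Nat.cast_pow,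
      Nat.cast_ofNat]
    ring
  simp_rw [h]
  rw [Finset.sum_sub_distrib, Finset.sum_const, Finset.card_univ, Finset.mul_sum]
  simp only [Fintype.card_fun, Fintype.card_fin, nsmul_eq_mul, Nat.cast_pow]

/-- Parseval for a `±1`-valued function: `Σ_S F̂(S)² = 1`. -/
theorem sum_sq_coeff_sgn (f : (Fin n → Bool) → Bool) :
    ∑ S, cubeFourierCoeff (fun x => sgn (f x)) S ^ 2 = 1 := by
  rw [sum_cubeFourierCoeff_sq]
  have h : ∀ x, sgn (f x) ^ 2 = (1 : ℝ) := fun x => by cases f x <;> simp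
  simp only [h, Finset.sum_const, Finset.card_univ, Fintype.card_fun, Fintype.card_bool,
    Fintype.card_fin, nsmul_eq_mul, mul_one, Nat.cast_pow, Nat.cast_ofNat]
  exact div_self (by positivity)

/-- Translation by `π^*σ` is a bijection of the cube (an involution). -/
theorem sum_translate (σ : Fin m → Bool) (π : Fin n → Fin m) (φ : (Fin n → Bool) → ℝ) :
    ∑ x : Fin n → Bool, φ (fun i => xor (x i) (σ (π i))) = ∑ x, φ x := by
  have hinv : Function.Involutive (fun x : Fin n → Bool => fun i => xor (x i) (σ (π i))) :=
    fun x => funext fun i => by simp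
  exact Fintype.sum_bijective (fun x : Fin n → Bool => fun i => xor (x i) (σ (π i))) hinv.bijective
    (fun x => φ (fun i => xor (x i) (σ (π i)))) φ fun _ => rfl

/-- **Averaging over translates**: if for every `x` the translates `σ ↦ s(x ⊕ π^*σ)` sum to at
most `2^m B`, then `Σ_y s(y) ≤ 2^n B`. -/
theorem sum_le_of_translates (π : Fin n → Fin m) (s : (Fin n → Bool) → ℝ) (B : ℝ)
    (h : ∀ x : Fin n → Bool, ∑ σ : Fin m → Bool, s (fun i => xor (x i) (σ (π i))) ≤ 2 ^ m * B) :
    ∑ y, s y ≤ 2 ^ n * B := by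
  have hsum : ∑ _σ : Fin m → Bool, ∑ y, s y ≤ ∑ _x : Fin n → Bool, 2 ^ m * B :=
    calc ∑ _σ : Fin m → Bool, ∑ y, s y
        = ∑ σ : Fin m → Bool, ∑ x : Fin n → Bool, s (fun i => xor (x i) (σ (π i))) :=
          Finset.sum_congr rfl fun σ _ => (sum_translate σ π s).symm
      _ = ∑ x : Fin n → Bool, ∑ σ : Fin m → Bool, s (fun i => xor (x i) (σ (π i))) :=
          Finset.sum_comm
      _ ≤ ∑ _x : Fin n → Bool, 2 ^ m * B := Finset.sum_le_sum fun x _ => h x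
  simp only [Finset.sum_const, Finset.card_univ, Fintype.card_fun, Fintype.card_bool,
    Fintype.card_fin, nsmul_eq_mul, Nat.cast_pow, Nat.cast_ofNat] at hsum
  have h2m : (0 : ℝ) < 2 ^ m := by positivity
  refine le_of_mul_le_mul_left ?_ h2m
  calc (2 : ℝ) ^ m * ∑ y, s y ≤ 2 ^ n * (2 ^ m * B) := hsum
    _ = 2 ^ m * (2 ^ n * B) := by ring

/-- Flipping bit `j` of `σ` flips block `π⁻¹(j)` of `x ⊕ π^*σ`:
`a ⊕ (σ^{⊕j})_l = (a ⊕ σ_l) ⊕ [l = j]`. -/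
theorem xor_update_not (a : Bool) (σ : Fin m → Bool) (j l : Fin m) :
    xor a (Function.update σ j (!σ j) l) = xor (xor a (σ l)) (decide (l = j)) := by
  by_cases h : l = j
  · subst h; simp
  · simp [h]

/-- **A translate of a linear threshold function along a partition is a linear threshold function
of the block bits**: `[θ ≤ Σ_i w_i (x ⊕ π^*σ)_i] = [Θ ≤ Σ_l W_l σ_l]` with
`W_l = Σ_{π i = l} w_i (1 - 2 x_i)`, `Θ = θ - Σ_i w_i x_i` (since `[a ⊕ s] = [a] + [s](1 - 2[a])`). -/
theorem ltf_translate (w : Fin n → ℝ) (θ : ℝ) (π : Fin n → Fin m) (x : Fin n → Bool) :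
    ∃ (W : Fin m → ℝ) (Θ : ℝ), (fun σ : Fin m → Bool =>
        decide (θ ≤ ∑ i, w i * (if xor (x i) (σ (π i)) then (1 : ℝ) else 0))) =
      fun σ => decide (Θ ≤ ∑ l, W l * (if σ l then (1 : ℝ) else 0)) := by
  refine ⟨fun l => ∑ i ∈ univ.filter (fun i => π i = l), w i * (1 - 2 * (if x i then (1 : ℝ) else 0)),
    θ - ∑ i, w i * (if x i then (1 : ℝ) else 0), ?_⟩
  funext σ
  have key : ∑ i, w i * (if xor (x i) (σ (π i)) then (1 : ℝ) else 0) =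
      ∑ i, w i * (if x i then (1 : ℝ) else 0) +
        ∑ l, (∑ i ∈ univ.filter (fun i => π i = l), w i * (1 - 2 * (if x i then (1 : ℝ) else 0))) *
          (if σ l then (1 : ℝ) else 0) := by
    have e : ∀ i, w i * (if xor (x i) (σ (π i)) then (1 : ℝ) else 0) =
        w i * (if x i then (1 : ℝ) else 0) +
          w i * (1 - 2 * (if x i then (1 : ℝ) else 0)) * (if σ (π i) then (1 : ℝ) else 0) := by
      intro i
      cases x i <;> cases σ (π i) <;> norm_num
    simp_rw [e]
    rw [Finset.sum_add_distrib]
    congr 1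
    rw [← Finset.sum_fiberwise univ π
      (fun i => w i * (1 - 2 * (if x i then (1 : ℝ) else 0)) * (if σ (π i) then (1 : ℝ) else 0))]
    refine Finset.sum_congr rfl fun l _ => ?_
    rw [Finset.sum_mul]
    refine Finset.sum_congr rfl fun i hi => ?_
    simp only [Finset.mem_filter, Finset.mem_univ, true_and] at hi
    rw [hi]
  rw [key]
  exact decide_eq_decide.2 ⟨fun h => by linarith, fun h => by linarith⟩

/-- The final arithmetic: `m - 2s ≤ m T`, `(2/3)·tw ≤ 1 - T`, `s² = m` give `tw ≤ 3/s`. -/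
theorem final_bound {tw T s : ℝ} (hs : s * s = m) (hs0 : 0 < s)
    (h1 : (m : ℝ) - 2 * s ≤ m * T) (h2 : 2 / 3 * tw ≤ 1 - T) : tw ≤ 3 / s := by
  rw [le_div_iff₀ hs0]
  have hm : (0 : ℝ) < m := by rw [← hs]; positivity
  have h3 : (m : ℝ) * tw ≤ 3 * s := by nlinarith
  refine le_of_mul_le_mul_left ?_ hs0
  calc s * (tw * s) = m * tw := by rw [← hs]; ring
    _ ≤ 3 * s := h3
    _ = s * 3 := by ring

/-- `(1 - 2/m)^m ≤ 1/3` for `m ≥ 2` (`(1 - t/m)^m ≤ e^{-t}` and `e² ≥ 3`). -/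
theorem one_sub_div_pow_le_third (hm : 2 ≤ m) : (1 - 2 / (m : ℝ)) ^ m ≤ 1 / 3 := by
  have h1 : (1 - 2 / (m : ℝ)) ^ m ≤ Real.exp (-2) :=
    Real.one_sub_div_pow_le_exp_neg (by exact_mod_cast hm)
  have h2 : Real.exp (-2) ≤ 1 / 3 := by
    rw [Real.exp_neg, inv_eq_one_div, one_div_le_one_div (Real.exp_pos 2) (by norm_num)]
    have := Real.add_one_le_exp (2 : ℝ)
    linarith
  exact h1.trans h2

/-- **Peres' theorem from the block-sensitivity bound**: if for every partition `π` the number of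
pairs (point, sensitive block) is at most `2^n √m`, then `W^{≥m}[sgn ∘ f] ≤ 3/√m` (`m ≥ 10`). -/
theorem tailWeight_le_of_sens (hm : 10 ≤ m) (f : (Fin n → Bool) → Bool)
    (hδ : ∀ π : Fin n → Fin m, ∑ x : Fin n → Bool,
      ((univ.filter fun j : Fin m => f x ≠ f (fun i => xor (x i) (decide (π i = j)))).card : ℝ)
        ≤ 2 ^ n * Real.sqrt m) :
    tailWeight (fun x => sgn (f x)) m ≤ 3 / Real.sqrt m := by
  have hm1 : 1 ≤ m := by omega
  have hmpos : (0 : ℝ) < m := Nat.cast_pos.2 (by omega)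
  have hm2 : (2 : ℝ) ≤ m := by exact_mod_cast (show 2 ≤ m by omega)
  have hρ0 : (0 : ℝ) ≤ 1 - 2 / m := by rw [sub_nonneg, div_le_one hmpos]; exact hm2
  have hρ1 : 1 - 2 / (m : ℝ) ≤ 1 := by linarith [show (0 : ℝ) ≤ 2 / m by positivity]
  have hρm : (1 - 2 / (m : ℝ)) ^ m ≤ 1 / 3 := one_sub_div_pow_le_third (by omega)
  have hs : Real.sqrt m * Real.sqrt m = m := Real.mul_self_sqrt hmpos.le
  have hs0 : 0 < Real.sqrt m := Real.sqrt_pos.2 hmpos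
  -- the double count of `Σ_π Σ_j Σ_x F(x) F(x ⊕ e_{π,j})`
  have hS := spectral_side hm1 (fun x => sgn (f x))
  have hCnt := counting_side (m := m) f
  have hsens : ∑ π : Fin n → Fin m, ∑ x : Fin n → Bool,
      ((univ.filter fun j : Fin m => f x ≠ f (fun i => xor (x i) (decide (π i = j)))).card : ℝ) ≤
        (m : ℝ) ^ n * (2 ^ n * Real.sqrt m) := by
    calc _ ≤ ∑ _π : Fin n → Fin m, 2 ^ n * Real.sqrt m := Finset.sum_le_sum fun π _ => hδ π
      _ = _ := by
        simp only [Finset.sum_const, Finset.card_univ, Fintype.card_fun, Fintype.card_fin,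
          nsmul_eq_mul, Nat.cast_pow]
  have h1 : (m : ℝ) - 2 * Real.sqrt m ≤
      m * ∑ S : Finset (Fin n), cubeFourierCoeff (fun x => sgn (f x)) S ^ 2 * (1 - 2 / (m : ℝ)) ^ S.card := by
    have hK : (0 : ℝ) < 2 ^ n * (m : ℝ) ^ n := by positivity
    refine le_of_mul_le_mul_left ?_ hK
    have key : (m : ℝ) ^ n * (m * 2 ^ n) - 2 * ((m : ℝ) ^ n * (2 ^ n * Real.sqrt m)) ≤
        2 ^ n * (m : ℝ) ^ n * m *
          ∑ S : Finset (Fin n), cubeFourierCoeff (fun x => sgn (f x)) S ^ 2 * (1 - 2 / (m : ℝ)) ^ S.card := by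
      rw [← hS, hCnt]
      linarith
    calc 2 ^ n * (m : ℝ) ^ n * ((m : ℝ) - 2 * Real.sqrt m)
        = (m : ℝ) ^ n * (m * 2 ^ n) - 2 * ((m : ℝ) ^ n * (2 ^ n * Real.sqrt m)) := by ring
      _ ≤ _ := key
      _ = 2 ^ n * (m : ℝ) ^ n * (m * ∑ S : Finset (Fin n),
            cubeFourierCoeff (fun x => sgn (f x)) S ^ 2 * (1 - 2 / (m : ℝ)) ^ S.card) := by ring
  -- Parseval and the tail
  have hpar := sum_sq_coeff_sgn f
  have h2 : 2 / 3 * tailWeight (fun x => sgn (f x)) m ≤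
      ∑ S : Finset (Fin n), (cubeFourierCoeff (fun x => sgn (f x)) S ^ 2 -
        cubeFourierCoeff (fun x => sgn (f x)) S ^ 2 * (1 - 2 / (m : ℝ)) ^ S.card) := by
    rw [tailWeight, Finset.mul_sum]
    calc ∑ S ∈ univ.filter (fun S : Finset (Fin n) => m ≤ S.card),
          2 / 3 * cubeFourierCoeff (fun x => sgn (f x)) S ^ 2
        ≤ ∑ S ∈ univ.filter (fun S : Finset (Fin n) => m ≤ S.card),
            (cubeFourierCoeff (fun x => sgn (f x)) S ^ 2 -
              cubeFourierCoeff (fun x => sgn (f x)) S ^ 2 * (1 - 2 / (m : ℝ)) ^ S.card) := by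
          refine Finset.sum_le_sum fun S hS => ?_
          simp only [Finset.mem_filter, Finset.mem_univ, true_and] at hS
          have hρS : (1 - 2 / (m : ℝ)) ^ S.card ≤ 1 / 3 :=
            (pow_le_pow_of_le_one hρ0 hρ1 hS).trans hρm
          nlinarith [sq_nonneg (cubeFourierCoeff (fun x => sgn (f x)) S)]
      _ ≤ ∑ S, (cubeFourierCoeff (fun x => sgn (f x)) S ^ 2 -
            cubeFourierCoeff (fun x => sgn (f x)) S ^ 2 * (1 - 2 / (m : ℝ)) ^ S.card) := by
          refine Finset.sum_le_univ_sum_of_nonneg fun S => ?_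
          have : (1 - 2 / (m : ℝ)) ^ S.card ≤ 1 := pow_le_one₀ hρ0 hρ1
          nlinarith [sq_nonneg (cubeFourierCoeff (fun x => sgn (f x)) S)]
  rw [Finset.sum_sub_distrib, hpar] at h2
  exact final_bound hs hs0 h1 h2

end StubPeresTail

open StubPeresTail in
/-- **Stub `stub_peresTail` (line `Sketch`) — Peres' theorem in Fourier-tail form, from the
influence bound.** For a linear threshold function `f(x) = [θ ≤ Σ_i w_i x_i]` of `n` Boolean
variables and `m ≥ 1`, the Fourier weight of `sgn ∘ f` above level `m` is `≤ 3/√m`, uniformly in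
`n` and in the weights (Y. Peres 2004; O'Donnell 2014, §5.5), given the total-influence bound
`hInf` for threshold functions on `{0,1}^m`: random `m`-partition `π` of the variables,
`σ ↦ f(x ⊕ π^*σ)` is again a threshold function (`ltf_translate`), so by `hInf` and the
translation symmetry the block sensitivity is `≤ 2^n √m` (`sum_le_of_translates`); in the Walsh
basis this reads `Σ_S f̂(S)²(1 - (1-2/m)^{|S|}) ≤ 2/√m`, whence `(2/3)·W^{≥m} ≤ 2/√m` for
`m ≥ 10` (`tailWeight_le_of_sens`), and `W^{≥m} ≤ 1 ≤ 3/√m` for `m ≤ 9`. -/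
theorem stub_peresTail (n m : ℕ) (hm : 1 ≤ m) (w : Fin n → ℝ) (θ : ℝ)
    (hInf : ∀ (W : Fin m → ℝ) (Θ : ℝ),
      (∑ σ : Fin m → Bool,
          ((univ.filter fun j : Fin m =>
              decide (Θ ≤ ∑ l, W l * (if σ l then (1 : ℝ) else 0)) ≠
                decide (Θ ≤ ∑ l, W l * (if Function.update σ j (!σ j) l then (1 : ℝ) else 0))).card
            : ℝ))
        ≤ 2 ^ m * Real.sqrt m) :
    tailWeight (fun x : Fin n → Bool =>
        sgn (decide (θ ≤ ∑ i, w i * (if x i then (1 : ℝ) else 0)))) m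
      ≤ 3 / Real.sqrt m := by
  by_cases hm9 : m ≤ 9
  · -- small `m`: `W^{≥m} ≤ 1 ≤ 3/√m`
    have h1 : tailWeight (fun x : Fin n → Bool =>
        sgn (decide (θ ≤ ∑ i, w i * (if x i then (1 : ℝ) else 0)))) m ≤ 1 :=
      tailWeight_le_one (fun x => by
        cases decide (θ ≤ ∑ i, w i * (if x i then (1 : ℝ) else 0)) <;> simp) m
    refine h1.trans ?_
    rw [le_div_iff₀ (Real.sqrt_pos.2 (by exact_mod_cast hm)), one_mul]
    calc Real.sqrt m ≤ Real.sqrt ((3 : ℝ) ^ 2) :=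
          Real.sqrt_le_sqrt (by norm_num; exact_mod_cast hm9)
      _ = 3 := Real.sqrt_sq (by norm_num)
  · -- Peres' argument
    have hm10 : 10 ≤ m := by omega
    refine tailWeight_le_of_sens hm10
      (fun x => decide (θ ≤ ∑ i, w i * (if x i then (1 : ℝ) else 0))) fun π => ?_
    refine sum_le_of_translates π (fun y => ((univ.filter fun j : Fin m =>
        decide (θ ≤ ∑ i, w i * (if y i then (1 : ℝ) else 0)) ≠
          decide (θ ≤ ∑ i, w i * (if xor (y i) (decide (π i = j)) then (1 : ℝ) else 0))).card : ℝ))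
      (Real.sqrt m) fun x => ?_
    obtain ⟨W, Θ, hg⟩ := ltf_translate w θ π x
    have key : ∀ τ : Fin m → Bool, decide (Θ ≤ ∑ l, W l * (if τ l then (1 : ℝ) else 0)) =
        decide (θ ≤ ∑ i, w i * (if xor (x i) (τ (π i)) then (1 : ℝ) else 0)) :=
      fun τ => congrFun hg.symm τ
    have h1 := hInf W Θ
    simp_rw [key, xor_update_not] at h1
    exact h1

end Summit.QuantumAdvantage.QuantumAdvantage.Theorems.LiouvilleOrthogonalTC0

end
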